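import Summits.AtomisticToContinuum.Crystallization.Theorems.OverbindingBudgetEnergyPinning

/-!
# OverbindingBudget · decomp-a2c lens-4 g34 — part XXII-B: ENERGY PINNING (the cell pinned by energy-density optimality, not by stress)

Helper file under `--supports stmt-AtomisticToContinuum-31280` (RDEF = `Theses.OverbindingBudget.RobustDefectLimitWindows`); closes nothing.

Cuts ★ `OverbindingBudgetEnergyPinning.StackedCellPinningU Λ₁ s₁ s₂ t₁ t₂` (7d's binders verbatim + `Unstrained` + `9/10`-covering ⇒
`Pinned s₁ s₂ a b ∨ PinnedSq t₁ t₂ a b`) by ENERGY into three pieces, seam PROVED (`stackedCellPinningU_of_energy`, via lens-3's `stackedUniform`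
T/S dichotomy, `Λ₁ ≤ 17/16`):
* E1 `SiteEnergyFloorStrains e₁` [ANALYTIC·S, TRUE]: a `9/10`-covering texture with separation `≥ 9/10` whose MEAN half site energy on large cubes
  is `≥ e₁ + κ′` (`κ′ > 0`), `e₁` an upper bound on the ground-state energy per particle, has strained cubes — at separation `≥ 9/10 > 2^{-1/6}`
  every pair interaction is attractive, so a cube chunk's interaction energy is `≥ ½ Σ_{y ∈ F} siteEnergy ≥ (e₁ + κ′)·#F`, while
  `E(#F) ≤ (e₁ + κ′/2)·#F` eventually and `#F ≥ c ℓ³` by covering;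
* `EnergyTrialBound e₁`: `E(N) ≤ (e₁ + ε)·N` eventually — PROVED here from `limsup E(N)/N ≤ e₁` (`energyTrialBound_of_limsup_le`) and from any
  periodic trial configuration `Q` with `e(Q) ≤ e₁` (`energyTrialBound_of_periodic`, via `ChargedEnergyGapNegative.limsup_div_le_energyPerParticle`);
  of record `e₁ = −7175/10000` with `Q` = the certified fcc window configuration (`OnePercentFccWindow.energyPerParticle_fccPC_aW_le`, outside this
  file's import closure — a one-line discharge in a companion module);
* E2T `StrainedCellEnergyT Λ₁ s₁ s₂ e` / E2S `StrainedCellEnergyS Λ₁ t₁ t₂ e` [CERT·M, configuration-free in the cell]: an admissible stacked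
  configuration over an UNPINNED T-cell (S-cell) has mean half site energy `≥ e` on every large cube.  Proof of record = STRAIGHTENING: bound each
  inter-layer term below by its lateral minimum at its height, then use joint convexity of the stack energy in the GAP VECTOR (adjacent normal
  stiffness `≈ 14–21`, census TAG 177 (i), against `Σ_{s≥2} s²|φ_s''| ≈ 2`) to replace the gaps of a cube by their mean at boundary cost `O(ℓ²)`,
  leaving the uniform-stack cell energy `e_LB(a, b) = ½[φ₀(a,b) + 2 min_h Σ_s φ_{s,min}(a,b; s h)]`, whose excess over `e₁` off the box is the
  in-plane elastic penalty `½·K·ε²` (`K ≈ 8.6` isotropic, `≈ 2` deviatoric) minus the polytype-splitting loss `Δ_poly ≈ 1–2·10⁻⁴` of span-wise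
  lateral minimisation (at `e₁ = −0.7175`); the SITEWISE floor is NOT claimed (far layers pull a site's unconstrained gaps to the clean-W floor,
  loss `~10⁻³`).
Cones PROVED: XXIII `rdef_twentythird_of_recordK_energy[_ref]` = cone XXII of part XXII with ★ ↦ E1 ∧ `EnergyTrialBound e₁` ∧ E2T ∧ E2S
(`e₁ κ′` symbolic, `0 < κ′`; boxes `[s₁, s₂]`, `[t₁, t₂]` SYMBOLIC — the energy margin `½Kε² − Δ_poly` fixes their feasible half-width).
-/

noncomputable section

namespace Summit.AtomisticToContinuum.Crystallization.Theorems.OverbindingBudgetEnergyPinningCut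

open Metric
open scoped RealInnerProductSpace
open Literature.MathematicalPhysics.StatisticalMechanics (lennardJones groundStateEnergy)
open Summit.AtomisticToContinuum.Crystallization.Theses.OverbindingBudget (RobustDefectLimitWindows)
open Summit.AtomisticToContinuum.Crystallization.Theses.PricedLinkCensus (ChargedEnergyGap)
open Summit.AtomisticToContinuum.Crystallization.Theorems.OverbindingBudgetGradedBareness (CleanlessExcessT)
open Summit.AtomisticToContinuum.Crystallization.Theorems.OverbindingBudgetCoherentCut (CoherentResidual)
open Summit.AtomisticToContinuum.Crystallization.Theorems.OverbindingBudgetUniformCutStatements (GrossCleanBallsU)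
open Summit.AtomisticToContinuum.Crystallization.Theorems.OverbindingBudgetEdgeRelaxationStatements (StrainedCubes)
open Summit.AtomisticToContinuum.Crystallization.Theorems.OverbindingBudgetElasticSplitScale (CompressedVirialLaw)
open Summit.AtomisticToContinuum.Crystallization.Theorems.OverbindingBudgetElasticSplitShear (StressFree)
open Summit.AtomisticToContinuum.Crystallization.Theorems.OverbindingBudgetElasticSplitPeriodic (Unstrained)
open Summit.AtomisticToContinuum.Crystallization.Theorems.ChartedPlanarOrderChunkFloor (E3)
open Summit.AtomisticToContinuum.Crystallization.Theorems.ChartedPlanarOrderRigidityDoor (IsNash)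
open Summit.AtomisticToContinuum.Crystallization.Theorems.ChartedPlanarOrderDensityDichotomy (μS IsSep)
open Summit.AtomisticToContinuum.Crystallization.Theorems.ChartedPlanarOrderDoorLayered (Layered)
open Summit.AtomisticToContinuum.Crystallization.Theorems.ChartedPlanarOrderProfileSlavingLJ (IsStacked gapStress incr)
open Summit.AtomisticToContinuum.Crystallization.Theorems.ChartedPlanarOrderCleanScaleP (IsCleanP)
open Summit.AtomisticToContinuum.Crystallization.Theorems.ChartedPlanarOrderStackedUniform (stackedUniform)
open Summit.AtomisticToContinuum.Crystallization.Theorems.ChartedPlanarOrderTubeConvex (TubeConvexW' TubeConvexRef)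
open Summit.AtomisticToContinuum.Crystallization.Theorems.OverbindingBudgetScaleWidening (IsCleanW DoorPeriodicW)
open Summit.AtomisticToContinuum.Crystallization.Theorems.OverbindingBudgetTwoShellShape (TwoShellShape BarlowGluingW)
open Summit.AtomisticToContinuum.Crystallization.Theorems.OverbindingBudgetStackedRigidityW (StackedReductionW GapStressVanishesW)
open Summit.AtomisticToContinuum.Crystallization.Theorems.OverbindingBudgetStackedRigidityRef (RegistryPinningW)
open Summit.AtomisticToContinuum.Crystallization.Theorems.OverbindingBudgetRegistryCut (Pinned RegistryResidual RegistryTube RegistryMetric)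
open Summit.AtomisticToContinuum.Crystallization.Theorems.OverbindingBudgetRegistrySquare (PinnedSq)
open Summit.AtomisticToContinuum.Crystallization.Theorems.OverbindingBudgetRegistryDichotomy (IsTType IsSType RegistryGeometryW BalancedLocus
  SqRegistryGeometryW SqBalancedHeight SqRegistryMetric)
open Summit.AtomisticToContinuum.Crystallization.Theorems.OverbindingBudgetRegistryDichotomyCW (RegistryMetricCW SqRegistryMetricCW)
open Summit.AtomisticToContinuum.Crystallization.Theorems.OverbindingBudgetEnergyPinning (StackedCellPinningU rdef_twentysecond_of_recordK
  rdef_twentysecond_of_recordK_ref)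

/-! ## §1 The energy pieces -/

/-- The Lennard-Jones site energy `Σ'_{q ∈ Y, q ≠ y} V_LJ(dist y q)` (a `tsum`, absolutely convergent for separated `Y`); the same expression as
`CleanHull.siteEnergy` of `GappedShellCensusCleanLimitsHaveWindowsDefs`, restated to keep this file's imports inside the slot-7 chain. [folklore] -/
def siteEnergy (Y : Set E3) (y : E3) : ℝ :=
  ∑' q : {q : E3 // q ∈ Y ∧ q ≠ y}, lennardJones (dist y (q : E3))

/-- **`EnergyTrialBound e₁`** — the trial-state bound on the `N`-particle Lennard-Jones ground-state energy: `E(N) ≤ (e₁ + ε)·N` eventually, for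
every `ε > 0` (junk-free form of `limsup E(N)/N ≤ e₁`).  IN TREE at `e₁ = −7175/10000` (periodic trial states + the certified fcc lattice sum
`OnePercentFccWindow.energyPerParticle_fccPC_aW_le`, or `ZeroDefectDensityBirth.hb_lim_le` with `BlancLewin2015_8_holds`); sharper values
(`−0.71758` from a certified hcp sum) shrink the boxes. [KNOWN at −0.7175; piece] -/
def EnergyTrialBound (e₁ : ℝ) : Prop :=
  ∀ ε : ℝ, 0 < ε → ∀ᶠ N : ℕ in Filter.atTop, groundStateEnergy lennardJones 3 N ≤ (e₁ + ε) * N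

/-- `limsup E(N)/N ≤ e₁ → EnergyTrialBound e₁` (the sequence is bounded above by `0`, `ChargedEnergyGapNegative.groundStateEnergy_nonpos`); with
`ChargedEnergyGapNegative.limsup_div_le_energyPerParticle Q` every periodic trial configuration `Q` with `e(Q) ≤ e₁` discharges the leaf
(of record: `OnePercentFccWindow.energyPerParticle_fccPC_aW_le`, `e₁ = −7175/10000`). [this file] -/
theorem energyTrialBound_of_limsup_le {e₁ : ℝ}
    (h : Filter.limsup (fun N : ℕ => groundStateEnergy lennardJones 3 N / N) Filter.atTop ≤ e₁) : EnergyTrialBound e₁ := by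
  intro ε hε
  have hlt : Filter.limsup (fun N : ℕ => groundStateEnergy lennardJones 3 N / N) Filter.atTop < e₁ + ε := lt_of_le_of_lt h (by linarith)
  have hbdd : Filter.IsBoundedUnder (· ≤ ·) Filter.atTop (fun N : ℕ => groundStateEnergy lennardJones 3 N / N) := by
    refine Filter.isBoundedUnder_of ⟨0, fun N => ?_⟩
    rcases Nat.eq_zero_or_pos N with rfl | hN
    · simp
    · exact div_nonpos_iff.2 (Or.inr ⟨ChargedEnergyGapNegative.groundStateEnergy_nonpos N, Nat.cast_nonneg N⟩)
  filter_upwards [Filter.eventually_lt_of_limsup_lt hlt hbdd] with N hN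
  rcases Nat.eq_zero_or_pos N with rfl | hN0
  · simp [Literature.MathematicalPhysics.StatisticalMechanics.groundStateEnergy_of_le_one]
  · have hNpos : (0 : ℝ) < N := by exact_mod_cast hN0
    exact ((div_lt_iff₀ hNpos).1 hN).le

/-- `EnergyTrialBound e₁` from any periodic trial configuration `Q` with `e(Q) ≤ e₁` (`…Negative.BlocksBound.limsup_div_le_energyPerParticle`). [this file] -/
theorem energyTrialBound_of_periodic {e₁ : ℝ} (Q : Literature.MathematicalPhysics.StatisticalMechanics.PeriodicConfiguration 3)
    (hQ : Q.energyPerParticle lennardJones ≤ e₁) : EnergyTrialBound e₁ :=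
  energyTrialBound_of_limsup_le ((ChargedEnergyGapNegative.limsup_div_le_energyPerParticle Q).trans hQ)

/-- **`MeanSiteEnergyFloor e Y`** — on every large half-open coordinate cube (the cubes of `StrainedCubes`, verbatim) the chunk's MEAN half site
energy is at least `e`: `e·#F ≤ Σ_{y ∈ F} siteEnergy Y y / 2`. -/
def MeanSiteEnergyFloor (e : ℝ) (Y : Set E3) : Prop :=
  ∃ ℓ₁ : ℝ, ∀ ℓ : ℝ, ℓ₁ ≤ ℓ → ∀ (c : E3) (F : Finset E3),
    (↑F : Set E3) = Y ∩ {z | ∀ i : Fin 3, c i ≤ z i ∧ z i < c i + ℓ} → e * F.card ≤ ∑ y ∈ F, siteEnergy Y y / 2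

/-- **E1 · `SiteEnergyFloorStrains e₁`** — a `9/10`-covering texture with separation `≥ 9/10` whose mean half site energy on large cubes is
`≥ e₁ + κ′`, `κ′ > 0`, where `e₁` bounds the ground-state energy per particle from above, has STRAINED CUBES.  Mechanism: at separation
`≥ 9/10 > 2^{-1/6}` every pair interaction is attractive, so a chunk's interaction energy `½ Σ_{y,w ∈ F} V` is `≥ ½ Σ_{y ∈ F} siteEnergy Y y ≥
(e₁ + κ′)·#F`, while `E(#F) ≤ (e₁ + κ′/2)·#F` once `#F` is large, and `#F ≥ c·ℓ³` by covering.  Why it might fail: it does not (bookkeeping of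
the `tsum` against the finite chunk sum needs the summability that separation gives). [ANALYTIC·S, TRUE] [piece] -/
def SiteEnergyFloorStrains (e₁ : ℝ) : Prop :=
  ∀ κ' : ℝ, 0 < κ' → ∀ δ : ℝ, 9 / 10 ≤ δ → ∀ Y : Set E3, IsSep δ Y → (∀ z : E3, ∃ p ∈ Y, dist z p ≤ 9 / 10) → EnergyTrialBound e₁ →
    MeanSiteEnergyFloor (e₁ + κ') Y → ∃ κ : ℝ, 0 < κ ∧ StrainedCubes κ Y

/-- **E2T · `StrainedCellEnergyT Λ₁ s₁ s₂ e`** — THE CELL-ENERGY CERTIFICATE, T branch: an admissible stacked configuration (7d's binders,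
separation `≥ 9/10`) whose T-type cell is NOT pinned in `[s₁, s₂]` has mean half site energy `≥ e` on every large cube.  Configuration-free in
the cell after STRAIGHTENING (module docstring (2)): `e ≤ e_LB(a, b) := ½[φ₀(a, b) + 2·min_h Σ_{s≥1} φ_{s,min}(a, b; s·h)] − o(1)` off the box,
by joint convexity of the stack energy in the gap vector (adjacent normal stiffness `≥ 14` vs `Σ_{s≥2} s²|φ_s''| ≈ 2`) and span-wise lateral
minimisation.  Why it might fail: the margin — at `e = −0.7175 + κ′` the polytype-splitting loss `Δ_poly ≈ 1–2·10⁻⁴` of span-wise minimisation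
must be beaten by the elastic penalty `½Kε²` at the box edge (`K ≈ 8.6` isotropic ⇒ half-width `≳ 0.6 %`; deviatoric `K ≈ 2` ⇒ `≳ 1.2 %`
unless `e₁` is sharpened to `−0.71758` and spans `1, 2` are minimised jointly). [CERT·M] [piece] -/
def StrainedCellEnergyT (Λ₁ s₁ s₂ e : ℝ) : Prop :=
  ∀ δ : ℝ, 9 / 10 ≤ δ → ∀ (a b : E3) (w : ℤ → E3), IsStacked a b w → LinearIndependent ℝ ![a, b] →
    ‖a‖ ≤ Λ₁ → ‖b‖ ≤ Λ₁ → IsSep δ (Layered a b w) → IsCleanW (μS (Layered a b w)) → IsNash (μS (Layered a b w)) →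
    StressFree (Layered a b w) → (∀ m : ℤ, gapStress a b m (incr w) = 0) → IsTType a b → ¬ Pinned s₁ s₂ a b →
    MeanSiteEnergyFloor e (Layered a b w)

/-- **E2S · `StrainedCellEnergyS Λ₁ t₁ t₂ e`** — the cell-energy certificate, S branch (square layers, box `[t₁, t₂]` round the fcc `{100}` cell;
same mechanism, adjacent stiffness `≥ 15`, `K_fit` doubles).  Why it might fail: as E2T; the S box sits `7·10⁻⁵` (fcc vs hcp) closer to `e₁`.
[CERT·M] [piece] -/
def StrainedCellEnergyS (Λ₁ t₁ t₂ e : ℝ) : Prop :=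
  ∀ δ : ℝ, 9 / 10 ≤ δ → ∀ (a b : E3) (w : ℤ → E3), IsStacked a b w → LinearIndependent ℝ ![a, b] →
    ‖a‖ ≤ Λ₁ → ‖b‖ ≤ Λ₁ → IsSep δ (Layered a b w) → IsCleanW (μS (Layered a b w)) → IsNash (μS (Layered a b w)) →
    StressFree (Layered a b w) → (∀ m : ℤ, gapStress a b m (incr w) = 0) → IsSType a b → ¬ PinnedSq t₁ t₂ a b →
    MeanSiteEnergyFloor e (Layered a b w)

/-- ★ **the energy seam, PROVED.** `SiteEnergyFloorStrains e₁ → EnergyTrialBound e₁ → StrainedCellEnergyT Λ₁ s₁ s₂ (e₁ + κ′) →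
StrainedCellEnergyS Λ₁ t₁ t₂ (e₁ + κ′) → StackedCellPinningU Λ₁ s₁ s₂ t₁ t₂` for `0 < κ′`, `Λ₁ ≤ 17/16`: by lens-3's `stackedUniform` the cell is
T-type or S-type (7d's `IsCleanW` is `IsCleanP (103/100)` by `rfl`); an unpinned cell would give the energy floor, hence strained cubes,
contradicting `Unstrained`. [this file] -/
theorem stackedCellPinningU_of_energy {Λ₁ s₁ s₂ t₁ t₂ e₁ κ' : ℝ} (hκ' : 0 < κ') (hΛ₁ : Λ₁ ≤ 17 / 16) (hE : SiteEnergyFloorStrains e₁)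
    (hTr : EnergyTrialBound e₁) (hT : StrainedCellEnergyT Λ₁ s₁ s₂ (e₁ + κ')) (hS : StrainedCellEnergyS Λ₁ t₁ t₂ (e₁ + κ')) :
    StackedCellPinningU Λ₁ s₁ s₂ t₁ t₂ := by
  intro δ hδ a b w hst hab ha hb hs hc hna hf hz hU hcov
  have hδ0 : (0 : ℝ) < δ := by linarith
  have hc' : IsCleanP (103 / 100) (μS (Layered a b w)) := hc
  obtain ⟨ν, -, -, -, -, -, -, -, hTS⟩ :=
    stackedUniform (by norm_num : (103 / 100 : ℝ) ≤ 8 / 7) hδ0 hs hc' hst (ha.trans hΛ₁) (hb.trans hΛ₁)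
  rcases hTS with ⟨hT', -⟩ | ⟨hS', -⟩
  · by_cases hp : Pinned s₁ s₂ a b
    · exact Or.inl hp
    · exfalso
      obtain ⟨κ, hκ, hstr⟩ := hE κ' hκ' δ hδ _ hs hcov hTr (hT δ hδ a b w hst hab ha hb hs hc hna hf hz hT' hp)
      exact hU κ hκ hstr
  · by_cases hp : PinnedSq t₁ t₂ a b
    · exact Or.inr hp
    · exfalso
      obtain ⟨κ, hκ, hstr⟩ := hE κ' hκ' δ hδ _ hs hcov hTr (hS δ hδ a b w hst hab ha hb hs hc hna hf hz hS' hp)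
      exact hU κ hκ hstr

/-! ## §2 The cones -/

/-- ★ **RDEF cone, TWENTY-THIRD form at the numbers of record: ENERGY PINNING** (W′ currency): cone XXII with ★ `StackedCellPinningU` cut by
energy — leaves E1 `SiteEnergyFloorStrains e₁` ∧ `EnergyTrialBound e₁` ∧ E2T `StrainedCellEnergyT (17/16) s₁ s₂ (e₁ + κ′)` ∧ E2S
`StrainedCellEnergyS (17/16) t₁ t₂ (e₁ + κ′)` (`e₁ κ′` symbolic, `0 < κ′`; of record `e₁ = −7175/10000`, where `EnergyTrialBound` is in tree). [this file] -/
theorem rdef_twentythird_of_recordK_energy (s₁ s₂ t₁ t₂ h₀ h₁ e₁ κ' : ℝ) (hκ' : 0 < κ') (hG : GrossCleanBallsU (1 / 250) 10)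
    (hCEG : ChargedEnergyGap) (hC : CompressedVirialLaw (1 / 250) 10) (hS : TwoShellShape (1 / 100) (3 / 50) (1 / 450)) (hB₂ : BarlowGluingW)
    (hD : DoorPeriodicW 2) (hSR : StackedReductionW 2 (17 / 16)) (hV : GapStressVanishesW (17 / 16))
    (hP : RegistryPinningW (17 / 16) (1 / 40) (3 / 16)) (hT : TubeConvexW' (17 / 16) (1 / 40)) (hE1 : SiteEnergyFloorStrains e₁)
    (hTr : EnergyTrialBound e₁) (hET : StrainedCellEnergyT (17 / 16) s₁ s₂ (e₁ + κ')) (hES : StrainedCellEnergyS (17 / 16) t₁ t₂ (e₁ + κ'))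
    (hGeo : RegistryGeometryW (17 / 16) s₁ s₂ h₀ (3 / 20)) (hBal : BalancedLocus s₁ s₂ h₀ (1 / 40)) (hR1 : RegistryResidual s₁ s₂ (1 / 250))
    (hR2 : RegistryTube s₁ s₂ (1 / 100) 1) (hMet : RegistryMetric s₁ s₂ (3 / 500)) (hSqGeo : SqRegistryGeometryW (17 / 16) t₁ t₂ h₁ (3 / 20))
    (hSqH : SqBalancedHeight t₁ t₂ h₁ (1 / 100)) (hSqMet : SqRegistryMetric t₁ t₂ h₁ (1 / 100) 0) (hCE : CleanlessExcessT)
    (hRes : CoherentResidual 10) : RobustDefectLimitWindows :=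
  rdef_twentysecond_of_recordK s₁ s₂ t₁ t₂ h₀ h₁ hG hCEG hC hS hB₂ hD hSR hV hP hT (stackedCellPinningU_of_energy hκ' le_rfl hE1 hTr hET hES)
    hGeo hBal hR1 hR2 hMet hSqGeo hSqH hSqMet hCE hRes

/-- ★ **RDEF cone, twenty-third form at the numbers of record, reference-centred (CURRENCY OF RECORD): ENERGY PINNING.** [this file] -/
theorem rdef_twentythird_of_recordK_energy_ref (s₁ s₂ t₁ t₂ h₀ h₁ e₁ κ' : ℝ) (hκ' : 0 < κ') (hG : GrossCleanBallsU (1 / 250) 10)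
    (hCEG : ChargedEnergyGap) (hC : CompressedVirialLaw (1 / 250) 10) (hS : TwoShellShape (1 / 100) (3 / 50) (1 / 450)) (hB₂ : BarlowGluingW)
    (hD : DoorPeriodicW 2) (hSR : StackedReductionW 2 (17 / 16)) (hV : GapStressVanishesW (17 / 16))
    (hP : RegistryPinningW (17 / 16) (1 / 40) (3 / 16)) (hT : TubeConvexRef (17 / 16) (1 / 40)) (hE1 : SiteEnergyFloorStrains e₁)
    (hTr : EnergyTrialBound e₁) (hET : StrainedCellEnergyT (17 / 16) s₁ s₂ (e₁ + κ')) (hES : StrainedCellEnergyS (17 / 16) t₁ t₂ (e₁ + κ'))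
    (hGeo : RegistryGeometryW (17 / 16) s₁ s₂ h₀ (3 / 20)) (hBal : BalancedLocus s₁ s₂ h₀ (1 / 40)) (hR1 : RegistryResidual s₁ s₂ (1 / 250))
    (hR2 : RegistryTube s₁ s₂ (1 / 100) 1) (hMet : RegistryMetricCW s₁ s₂ (3 / 500))
    (hSqGeo : SqRegistryGeometryW (17 / 16) t₁ t₂ h₁ (3 / 20)) (hSqH : SqBalancedHeight t₁ t₂ h₁ (1 / 100))
    (hSqMet : SqRegistryMetricCW t₁ t₂ h₁ (1 / 100) 0) (hCE : CleanlessExcessT) (hRes : CoherentResidual 10) : RobustDefectLimitWindows :=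
  rdef_twentysecond_of_recordK_ref s₁ s₂ t₁ t₂ h₀ h₁ hG hCEG hC hS hB₂ hD hSR hV hP hT
    (stackedCellPinningU_of_energy hκ' le_rfl hE1 hTr hET hES) hGeo hBal hR1 hR2 hMet hSqGeo hSqH hSqMet hCE hRes

end Summit.AtomisticToContinuum.Crystallization.Theorems.OverbindingBudgetEnergyPinningCut

end
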